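import Summits.FinalStateConjecture.FinalStateConjecture.Statement
import HarnessLib

/-!
# FinalStateConjecture — summit statement (D-0017)

Single-conjunct summit: the statement `FinalStateConjecture : Prop` (root level, docstring tag
`[problem: gr]`) is defined in `Summits/FinalStateConjecture/FinalStateConjecture/Statement.lean`;
this file re-exports it by import. Target path: `lean/Summits/FinalStateConjecture/Statement.lean`.
-/
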